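import Summits.ABC.ABC.Theorems.SoloBlindPolyABC
import HarnessLib

/-!
# No covering identity gains exponent (the transfer bookkeeping of C4 / C4″)

Solo seat `solo-ABC-blind` (ideation tier, summit-directed), session 6.

A *covering* of degree `n` with `v`-surplus exponent `s` (hypothesis `hD` below, "CoveringData n s") assigns to every
coprime pair `0 < u < v` an abc triple `(a, b, c)` — the normalised image of `(u, v − u, v)` under
some identity — with

* height gain: `κ · vⁿ ≤ c`, and
* radical loss: `rad(abc) ≤ M · rad(u v (v − u)) · v^s`.

Every homogeneous polynomial identity `A(u,v) + B(u,v) = C(u,v)` of degree `n` over `ℤ` gives such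
data with `s = r − r₀`, where `r = deg rad(ABC) + [deg(ABC) < 3n]` and `r₀ ≤ 3` counts which of
`u, v, v − u` divide `ABC`; by the projective Mason–Stothers count
(`Literature.NumberTheory.DiophantineGeometry.Mason1984.mason_projective`) `r ≥ n + 2`, hence
`s ≥ n − 1`.  (That instantiation — evaluation of binary forms — is not formalised here; the power
map `uⁿ + (vⁿ − uⁿ) = vⁿ`, which attains `s = n − 1`, is: `coveringData_powMap`.)

Results:
* `radFloor_of_coveringData`: `CoveringData n s ∧ PolyABC K ⟹ rad(u v (v−u)) ≥ κ' · v^{(n − K s)/K}`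
  — the transferred floor exponent is `(n − K s)/K`.
* `transfer_exponent_le`: if `s + 1 ≥ n` (Mason–Stothers) and `K ≥ 1` (the only interesting range,
  since `PolyABC K` fails for `K ≤ 1`, `not_polyABC_one`), then `(n − K s)/K ≤ 1/K`: the transfer
  never beats the floor exponent `1/K` that `PolyABC K` gives directly (`radLowerBound_of_polyABC`,
  `n = 1`), with equality iff `K · s = n − 1`, i.e. (for `n ≥ 2`) iff `K = 1 ∧ s = n − 1` —
  the Belyi-extremal, lossless case (`transfer_exponent_eq_iff`).
So polynomial exponents cannot be bootstrapped through coverings; only `K = 1` (abc itself) is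
transported without loss, and only by the extremal identities — which is what the self-reductions
`abc_iff_abcOnPowEnds`, `abc_iff_pythagorean`, `abc_iff_congruenceABC` do.

References: Mason 1984 [Mason1984]; the seat's WALL.md C4, C4″.
-/

noncomputable section

open UniqueFactorizationMonoid

namespace Summit.ABC.ABC.Theorems

open Literature.NumberTheory.DiophantineGeometry

/-! `CoveringData n s` below is spelled out, not named (no new definitions in this file): it is the
hypothesis `∃ κ M > 0, ∀ coprime 0 < u < v, ∃ abc triple (a,b,c), κ vⁿ ≤ c ∧ rad(abc) ≤ M · rad(u v (v−u)) · v^s`. -/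

/-- The power map `(u, v−u, v) ↦ (uⁿ, vⁿ − uⁿ, vⁿ)` is a covering of degree `n` with surplus
exponent `n − 1` (`rad(u v (vⁿ−uⁿ)) ≤ n · v^{n−1} · rad(u v (v−u))`). [folklore] -/
theorem coveringData_powMap {n : ℕ} (hn : 1 ≤ n) :
    ∃ κ M : ℝ, 0 < κ ∧ 0 < M ∧ ∀ u v : ℕ, 0 < u → u < v → Nat.Coprime u v →
      ∃ a b c : ℕ, IsABCTriple a b c ∧ κ * (v : ℝ) ^ n ≤ (c : ℝ) ∧
        ((rad a b c : ℕ) : ℝ) ≤ M * ((radical (u * v * (v - u)) : ℕ) : ℝ) * (v : ℝ) ^ (n - 1) := by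
  refine ⟨1, n, one_pos, by exact_mod_cast hn, fun u v hu huv hcop => ?_⟩
  refine ⟨u ^ n, v ^ n - u ^ n, v ^ n, isABCTriple_pow_sub_pow hn hu huv hcop, ?_, ?_⟩
  · push_cast; simp
  · obtain ⟨k, rfl⟩ : ∃ k, n = k + 1 := ⟨n - 1, by omega⟩
    have htri : IsABCTriple u (v - u) v :=
      ⟨hu, by omega, by omega, (Nat.coprime_sub_self_right huv.le).mpr hcop⟩
    have h := radical_form_le u (v - u) v k htri
    rw [rad_def] at h
    rw [rad_pow_sub_pow hn hu huv]
    simp only [add_tsub_cancel_right]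
    calc ((radical (u * v * (v ^ (k + 1) - u ^ (k + 1))) : ℕ) : ℝ)
        ≤ ((k : ℝ) + 1) * (v : ℝ) ^ k * ((radical (u * (v - u) * v) : ℕ) : ℝ) := h
      _ = (((k + 1 : ℕ)) : ℝ) * ((radical (u * v * (v - u)) : ℕ) : ℝ) * (v : ℝ) ^ k := by
          rw [mul_right_comm u (v - u) v]; push_cast; ring

/-- **Transfer through a covering.**  A covering of degree `n` with surplus `s` turns `PolyABC K`
into the radical floor `κ' · v^{(n − K s)/K} ≤ rad(u v (v − u))`. [folklore] -/
theorem radFloor_of_coveringData {n s : ℕ}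
    (hD : ∃ κ M : ℝ, 0 < κ ∧ 0 < M ∧ ∀ u v : ℕ, 0 < u → u < v → Nat.Coprime u v →
      ∃ a b c : ℕ, IsABCTriple a b c ∧ κ * (v : ℝ) ^ n ≤ (c : ℝ) ∧
        ((rad a b c : ℕ) : ℝ) ≤ M * ((radical (u * v * (v - u)) : ℕ) : ℝ) * (v : ℝ) ^ s)
    {K : ℝ} (hP : PolyABC K) :
    ∃ κ' : ℝ, 0 < κ' ∧ ∀ u v : ℕ, 0 < u → u < v → Nat.Coprime u v →
      κ' * (v : ℝ) ^ (((n : ℝ) - K * s) / K) ≤ ((radical (u * v * (v - u)) : ℕ) : ℝ) := by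
  have hK := polyABC_pos hP
  obtain ⟨C, hC, HC⟩ := hP
  obtain ⟨κ, M, hκ, hM, HD⟩ := hD
  refine ⟨(κ / (C * M ^ K)) ^ (1 / K), by positivity, fun u v hu huv hcop => ?_⟩
  obtain ⟨a, b, c, habc, hcv, hrad⟩ := HD u v hu huv hcop
  have h1 := HC a b c habc
  set ρ : ℝ := ((radical (u * v * (v - u)) : ℕ) : ℝ) with hρ
  have hρ0 : 0 ≤ ρ := by positivity
  have hv : (0 : ℝ) < v := by exact_mod_cast (hu.trans huv)
  have hR0 : (0 : ℝ) ≤ ((rad a b c : ℕ) : ℝ) := by positivity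
  have h2 : ((rad a b c : ℕ) : ℝ) ^ K ≤ (M * ρ * (v : ℝ) ^ s) ^ K :=
    Real.rpow_le_rpow hR0 hrad hK.le
  have h3 : κ * (v : ℝ) ^ n ≤ C * (M * ρ * (v : ℝ) ^ s) ^ K :=
    hcv.trans (h1.trans (mul_le_mul_of_nonneg_left h2 hC.le))
  have h4 : (M * ρ * (v : ℝ) ^ s) ^ K = M ^ K * ρ ^ K * (v : ℝ) ^ ((s : ℝ) * K) := by
    rw [Real.mul_rpow (by positivity) (by positivity), Real.mul_rpow hM.le hρ0,
      ← Real.rpow_natCast (v : ℝ) s, ← Real.rpow_mul hv.le]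
  rw [h4] at h3
  -- ρ^K ≥ κ/(C M^K) · v^(n − K s)
  have hCM : 0 < C * M ^ K := by positivity
  have h5 : κ / (C * M ^ K) * (v : ℝ) ^ ((n : ℝ) - K * s) ≤ ρ ^ K := by
    have hvpow : (v : ℝ) ^ ((n : ℝ) - K * s) = (v : ℝ) ^ n / (v : ℝ) ^ ((s : ℝ) * K) := by
      rw [Real.rpow_sub hv, Real.rpow_natCast, mul_comm K (s : ℝ)]
    have hvs : (0 : ℝ) < (v : ℝ) ^ ((s : ℝ) * K) := by positivity
    rw [hvpow, div_mul_div_comm, div_le_iff₀ (mul_pos hCM hvs)]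
    calc κ * (v : ℝ) ^ n ≤ C * (M ^ K * ρ ^ K * (v : ℝ) ^ ((s : ℝ) * K)) := h3
      _ = ρ ^ K * (C * M ^ K * (v : ℝ) ^ ((s : ℝ) * K)) := by ring
  -- take `1/K`-th powers
  have h6 := Real.rpow_le_rpow (by positivity) h5 (show (0 : ℝ) ≤ 1 / K by positivity)
  rw [← Real.rpow_mul hρ0, mul_one_div_cancel hK.ne', Real.rpow_one,
    Real.mul_rpow (by positivity) (by positivity), ← Real.rpow_mul hv.le] at h6
  have hexp : ((n : ℝ) - K * s) * (1 / K) = ((n : ℝ) - K * s) / K := by ring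
  rwa [hexp] at h6

/-- **No gain.**  With the Mason–Stothers surplus bound `n ≤ s + 1` and `K ≥ 1`, the transferred
floor exponent `(n − K s)/K` is at most `1/K` — the exponent `PolyABC K` yields directly
(`radLowerBound_of_polyABC` with `n = 1`). [folklore] -/
theorem transfer_exponent_le {n s : ℕ} {K : ℝ} (hs : n ≤ s + 1) (hK : 1 ≤ K) :
    ((n : ℝ) - K * s) / K ≤ 1 / K := by
  have hK0 : 0 < K := by linarith
  rw [div_le_div_iff_of_pos_right hK0]
  have hs' : (n : ℝ) ≤ s + 1 := by exact_mod_cast hs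
  have hs0 : (0 : ℝ) ≤ s := by positivity
  nlinarith

/-- The equality case: for `n ≤ s + 1`, `K ≥ 1`, the transfer is lossless
(`(n − K s)/K = 1/K`) iff `K · s = n − 1`, i.e. iff `s = 0 ∧ n = 1` (degree one) or
`K = 1 ∧ s = n − 1` (abc itself through a Belyi-extremal covering). [folklore] -/
theorem transfer_exponent_eq_iff {n s : ℕ} {K : ℝ} (hs : n ≤ s + 1) (hK : 1 ≤ K) :
    ((n : ℝ) - K * s) / K = 1 / K ↔ (s = 0 ∧ n = 1) ∨ (K = 1 ∧ s + 1 = n) := by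
  have hK0 : 0 < K := by linarith
  rw [div_eq_div_iff hK0.ne' hK0.ne']
  constructor
  · intro h
    have h' : (n : ℝ) - K * s = 1 := by
      have := mul_right_cancel₀ hK0.ne' h; linarith
    rcases Nat.eq_zero_or_pos s with hs0 | hs0
    · left
      subst hs0
      refine ⟨rfl, ?_⟩
      have : (n : ℝ) = 1 := by simpa using h'
      exact_mod_cast this
    · right
      have hs1 : (1 : ℝ) ≤ s := by exact_mod_cast hs0
      have hsR : (n : ℝ) ≤ s + 1 := by exact_mod_cast hs
      -- K s = n − 1 ≤ s, and K ≥ 1 ⟹ K = 1 and then s = n − 1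
      have hK1 : K = 1 := by
        by_contra hne
        have hlt : 1 < K := lt_of_le_of_ne hK (Ne.symm hne)
        nlinarith
      refine ⟨hK1, ?_⟩
      subst hK1
      have : (s : ℝ) + 1 = n := by linarith
      exact_mod_cast this
  · rintro (⟨rfl, rfl⟩ | ⟨rfl, hsn⟩)
    · simp
    · have : (n : ℝ) = s + 1 := by exact_mod_cast hsn.symm
      rw [this]; ring

/-- Assembled statement of C4: through the power map of degree `n ≥ 2`, `PolyABC K` (`K ≥ 1`)
returns only the floor exponent `(n − K (n−1))/K ≤ 1/K`, i.e. nothing beyond what it gives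
directly; more generally no covering with Mason–Stothers surplus `s ≥ n − 1` does. [folklore] -/
theorem no_covering_gain {n s : ℕ}
    (hD : ∃ κ M : ℝ, 0 < κ ∧ 0 < M ∧ ∀ u v : ℕ, 0 < u → u < v → Nat.Coprime u v →
      ∃ a b c : ℕ, IsABCTriple a b c ∧ κ * (v : ℝ) ^ n ≤ (c : ℝ) ∧
        ((rad a b c : ℕ) : ℝ) ≤ M * ((radical (u * v * (v - u)) : ℕ) : ℝ) * (v : ℝ) ^ s)
    (hs : n ≤ s + 1) {K : ℝ} (hK : 1 ≤ K) (hP : PolyABC K) :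
    ∃ θ κ' : ℝ, θ ≤ 1 / K ∧ 0 < κ' ∧ ∀ u v : ℕ, 0 < u → u < v → Nat.Coprime u v →
      κ' * (v : ℝ) ^ θ ≤ ((radical (u * v * (v - u)) : ℕ) : ℝ) := by
  obtain ⟨κ', hκ', H⟩ := radFloor_of_coveringData hD hP
  exact ⟨_, κ', transfer_exponent_le hs hK, hκ', H⟩

end Summit.ABC.ABC.Theorems

end
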